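import Literature.NumberTheory.LFunctions.WeilExplicit
import Mathlib.Analysis.SpecialFunctions.Gaussian.FourierTransform
import HarnessLib

/-!
# Mellin–Laplace transform of the heat Gaussian

Stub `stub_gaussMellin` of the line "Sketch (heat cone)" for the crux
`Summit.RiemannHypothesis.RiemannHypothesis.Theses.RuelleBand.ExactFirstBand`: for `u > 0` the
Gaussian test `g_u(t) = (4πu)^{-1/2} e^{-t²/(4u)}` has, in the tree's additive `1/2`-symmetric
normalisation `ĝ(s) = ∫ g(t) e^{(s-1/2)t} dt` (`Literature.NumberTheory.LFunctions.weilMellin`),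
the closed form `ĝ_u(s) = e^{u(s-1/2)²}` for every complex `s`.  Proof: complete the square,
i.e. Mathlib's `integral_cexp_quadratic` with `b = -1/(4u)`, `c = s - 1/2`, `d = 0`, and
`(π/(1/(4u)))^{1/2} = √(4πu)` cancels the normalising constant.
-/

set_option linter.dupNamespace false

noncomputable section

open Complex MeasureTheory Filter Set

namespace Summit.RiemannHypothesis.RiemannHypothesis.Theorems.RuelleBandExactFirstBand

open Literature.NumberTheory.LFunctions

/-- Pointwise form of the integrand: `(4πu)^{-1/2} e^{-t²/(4u)} · e^{(s-1/2)t}` equals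
`(√(4πu))⁻¹ · exp (b t² + (s-1/2) t + 0)` with `b = -1/(4u)` (a real number cast to `ℂ`,
so that `integral_cexp_quadratic` applies verbatim). -/
theorem stub_gaussMellin_integrand (u : ℝ) (s : ℂ) (t : ℝ) :
    ((Real.exp (-(t ^ 2) / (4 * u)) / Real.sqrt (4 * Real.pi * u) : ℝ) : ℂ) *
        cexp ((s - 1 / 2) * t) =
      ((Real.sqrt (4 * Real.pi * u) : ℝ) : ℂ)⁻¹ *
        cexp (((-(1 / (4 * u)) : ℝ) : ℂ) * (t : ℂ) ^ 2 + (s - 1 / 2) * t + 0) := by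
  rw [Complex.ofReal_div, Complex.ofReal_exp, div_eq_inv_mul, mul_assoc, ← Complex.exp_add]
  congr 2
  push_cast
  ring

/-- The square root of `4πu` as a complex power: `(4πu : ℂ)^{1/2} = √(4πu)` for `u > 0`. -/
theorem stub_gaussMellin_sqrt {u : ℝ} (hu : 0 < u) :
    ((4 * Real.pi * u : ℝ) : ℂ) ^ (1 / 2 : ℂ) =
      ((Real.sqrt (4 * Real.pi * u) : ℝ) : ℂ) := by
  rw [Real.sqrt_eq_rpow, Complex.ofReal_cpow (by positivity) (1 / 2)]
  norm_num

/-- **Mellin–Laplace transform of the heat Gaussian.** For `u > 0` and every `s : ℂ`,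
`∫ (4πu)^{-1/2} e^{-t²/(4u)} e^{(s-1/2)t} dt = e^{u(s-1/2)²}` (complete the square:
`integral_cexp_quadratic` with `b = -1/(4u)`, `c = s - 1/2`, `d = 0`; then
`(π/(-b))^{1/2} = √(4πu)` cancels the normalisation and `-c²/(4b) = u c²`). -/
theorem stub_gaussMellin :
    ∀ u : ℝ, 0 < u → ∀ s : ℂ,
      weilMellin
          (fun t : ℝ =>
            ((Real.exp (-(t ^ 2) / (4 * u)) / Real.sqrt (4 * Real.pi * u) : ℝ) : ℂ)) s =
        cexp ((u : ℂ) * (s - 1 / 2) ^ 2) := by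
  intro u hu s
  have hu0 : (u : ℂ) ≠ 0 := Complex.ofReal_ne_zero.2 hu.ne'
  have hb : (((-(1 / (4 * u)) : ℝ) : ℂ)).re < 0 := by
    rw [Complex.ofReal_re]
    have : 0 < 1 / (4 * u) := by positivity
    linarith
  have hsq0 : ((Real.sqrt (4 * Real.pi * u) : ℝ) : ℂ) ≠ 0 :=
    Complex.ofReal_ne_zero.2 (Real.sqrt_ne_zero'.2 (by positivity))
  have hquot :
      (Real.pi : ℂ) / -(((-(1 / (4 * u)) : ℝ) : ℂ)) = ((4 * Real.pi * u : ℝ) : ℂ) := by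
    push_cast
    field_simp
  have hexp : (0 : ℂ) - (s - 1 / 2) ^ 2 / (4 * (((-(1 / (4 * u)) : ℝ) : ℂ))) =
      (u : ℂ) * (s - 1 / 2) ^ 2 := by
    push_cast
    field_simp
    ring
  simp only [weilMellin]
  simp_rw [stub_gaussMellin_integrand u s]
  rw [integral_const_mul, integral_cexp_quadratic hb (s - 1 / 2) 0, hquot, hexp,
    stub_gaussMellin_sqrt hu, inv_mul_cancel_left₀ hsq0]

end Summit.RiemannHypothesis.RiemannHypothesis.Theorems.RuelleBandExactFirstBand

end
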